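import Literature.AnabelianGeometry.AbsoluteAnabelian.PuncturedEllipticCurveHyperbolicCore
import Literature.Geometry.Kaehler.RiemannSurfaceTorusMinusFiniteDiscCovering
import Literature.Analysis.Complex.PlaneDomainUniformizationHolds
import HarnessLib

/-!
# The universal covering of IUT's archimedean curves is the disc — UNCONDITIONAL

Layer `Literature/AnabelianGeometry/AbsoluteAnabelian`, PROOF-ONLY closer of the abc-iut programme
«UNIF-G1P» (GAP G-L4t8g7-1).  The named fact `Complex.PlaneDomainDiscCovering` (uniformization of plane
domains omitting two points; Koebe–Poincaré, Fisher–Hubbard–Wittner 1988) is now a THEOREM of the tree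
(`Complex.planeDomainDiscCovering_holds`, `Literature/Analysis/Complex/PlaneDomainUniformizationHolds.lean`,
landed by the cell's seats w6-d031, w5-d030, w5-d208, w5-d162, w5-d038, w5-d089 over the sub-bricks N1a,
N1b, SQRT-MAP, K1, K2, K3, λ-reduction/transport, covering criterion).  This file discharges the
hypothesis `(H : Complex.PlaneDomainDiscCovering)` of the programme's consumer theorems, giving
UNCONDITIONAL statements at the genuine objects of [AbsTopIII] §2 / [IUTchI] Def. 3.1:

* `exists_disc_covering_of_isPuncturedEllipticCurve'` — every once-punctured elliptic curve (typed
  `TorsionPointsDenseUniqueGroupLaw.IsPuncturedEllipticCurve`) is holomorphically covered by the disc;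
* `exists_universalCover_isAutHolDisc_of_isPuncturedEllipticCurve'` — the binders `(Ucov, p)` of
  `DeckGroupInAutIdComponent` / `HyperbolicCoreOrbispace` ([AbsTopIII] Cor. 2.4 (b)(c)) at genuine `E`;
* `exists_deckGroup_subset_autIdComponent_of_isPuncturedEllipticCurve'` — [AbsTopIII] Cor. 2.4 (b) at
  genuine `E`: `π₁(E) = Aut(𝔻/E) ⊆ Aut⁰(𝔻)`;
* `exists_hyperbolicCore_data_of_isPuncturedEllipticCurve'` — Cor. 2.4 (c) at genuine `E` under the
  printed non-arithmeticity hypothesis;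
* `ComplexTorus.exists_disc_covering_compl_finite'`, `RiemannSurface.exists_disc_covering_compl_finite_of_homeomorph_torus'`,
  `RiemannSurface.exists_disc_covering_of_biholomorphic_torus_minus_finite'` — the type `(1, r)` curves.

HONEST FRAMING: classical uniformization, OUR kernel check; nothing here bears on the disputed
[IUTchIII] Cor. 3.12.
-/

noncomputable section

open Set Function Metric TopologicalSpace
open scoped Manifold ContDiff Topology
open Literature.Geometry.Kaehler (ComplexTorus)

namespace Literature.Geometry.Kaehler

/-- **The disc holomorphically covers every complex torus minus a non-empty finite set** — unconditional.
[cite: FarkasKra1992, IV.6.1] -/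
theorem ComplexTorus.exists_disc_covering_compl_finite' {ι : Type} [Fintype ι] (Φ : (ι → ℝ) ≃L[ℝ] ℂ)
    {S : Set (ComplexTorus Φ)} (hS : S.Finite) (hne : S.Nonempty) :
    ∃ p : (⟨ball (0 : ℂ) 1, isOpen_ball⟩ : Opens ℂ) →
        (⟨Sᶜ, hS.isClosed.isOpen_compl⟩ : Opens (ComplexTorus Φ)),
      IsCoveringMap p ∧ Function.Surjective p ∧ MDifferentiable 𝓘(ℂ, ℂ) 𝓘(ℂ, ℂ) p :=
  ComplexTorus.exists_disc_covering_compl_finite Φ Complex.planeDomainDiscCovering_holds hS hne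

/-- **The disc holomorphically covers every compact genus-one Riemann surface minus a non-empty finite
set** (hyperbolic curves of type `(1, r)`) — unconditional. [cite: FarkasKra1992, IV.6.4] -/
theorem RiemannSurface.exists_disc_covering_compl_finite_of_homeomorph_torus' (T : Type)
    [TopologicalSpace T] [T2Space T] [CompactSpace T] [ConnectedSpace T] [ChartedSpace ℂ T]
    [IsManifold 𝓘(ℂ, ℂ) ω T] (e₀ : T ≃ₜ AddCircle (1 : ℝ) × AddCircle (1 : ℝ)) {S : Set T}
    (hS : S.Finite) (hne : S.Nonempty) :
    ∃ p : (⟨ball (0 : ℂ) 1, isOpen_ball⟩ : Opens ℂ) → (⟨Sᶜ, hS.isClosed.isOpen_compl⟩ : Opens T),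
      IsCoveringMap p ∧ Function.Surjective p ∧ MDifferentiable 𝓘(ℂ, ℂ) 𝓘(ℂ, ℂ) p :=
  RiemannSurface.exists_disc_covering_compl_finite_of_homeomorph_torus T
    Complex.planeDomainDiscCovering_holds e₀ hS hne

/-- **Every Riemann surface biholomorphic to a compact genus-one surface minus a non-empty finite set is
holomorphically covered by the disc** — unconditional. [cite: FarkasKra1992, IV.6.4] -/
theorem RiemannSurface.exists_disc_covering_of_biholomorphic_torus_minus_finite' {T : Type}
    [TopologicalSpace T] [T2Space T] [CompactSpace T] [ConnectedSpace T] [ChartedSpace ℂ T]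
    [IsManifold 𝓘(ℂ, ℂ) ω T] (e₀ : T ≃ₜ AddCircle (1 : ℝ) × AddCircle (1 : ℝ)) {S : Set T}
    (hS : S.Finite) (hne : S.Nonempty) {X : Type} [TopologicalSpace X] [ChartedSpace ℂ X]
    (φ : X ≃ₜ (⟨Sᶜ, hS.isClosed.isOpen_compl⟩ : Opens T))
    (hφ : MDifferentiable 𝓘(ℂ, ℂ) 𝓘(ℂ, ℂ) φ.symm) :
    ∃ p : (⟨ball (0 : ℂ) 1, isOpen_ball⟩ : Opens ℂ) → X,
      IsCoveringMap p ∧ Function.Surjective p ∧ MDifferentiable 𝓘(ℂ, ℂ) 𝓘(ℂ, ℂ) p :=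
  RiemannSurface.exists_disc_covering_of_biholomorphic_torus_minus_finite
    Complex.planeDomainDiscCovering_holds e₀ hS hne φ hφ

end Literature.Geometry.Kaehler

namespace Literature.AnabelianGeometry.AbsoluteAnabelian

namespace HolomorphicEllipticCuspidalization

variable (E : Type) [TopologicalSpace E] [T2Space E] [ChartedSpace ℂ E] [IsManifold 𝓘(ℂ, ℂ) ω E]

/-- **The disc holomorphically covers every once-punctured elliptic curve** ([AbsTopIII] Def. 2.1 (i) at
the genuine curve of type `(1,1)`) — unconditional. [cite: MochizukiAbsTopIII2015, Definition 2.1 (i) p.50] -/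
theorem exists_disc_covering_of_isPuncturedEllipticCurve'
    (hE : TorsionPointsDenseUniqueGroupLaw.IsPuncturedEllipticCurve E) :
    ∃ p : unitDiscOpens → E,
      IsCoveringMap p ∧ Function.Surjective p ∧ MDifferentiable 𝓘(ℂ, ℂ) 𝓘(ℂ, ℂ) p :=
  exists_disc_covering_of_isPuncturedEllipticCurve E Complex.planeDomainDiscCovering_holds hE

/-- **The universal-covering hypotheses `(Ucov, p)` of [AbsTopIII] Cor. 2.4 (b)(c) / Cor. 2.7 (a) HOLD at
every once-punctured elliptic curve** — unconditional. [cite: MochizukiAbsTopIII2015, Corollary 2.4 (b) p.54] -/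
theorem exists_universalCover_isAutHolDisc_of_isPuncturedEllipticCurve'
    (hE : TorsionPointsDenseUniqueGroupLaw.IsPuncturedEllipticCurve E) :
    ∃ (Ucov : Type) (_ : TopologicalSpace Ucov) (_ : SimplyConnectedSpace Ucov) (_ : ChartedSpace ℂ Ucov)
      (_ : IsManifold 𝓘(ℂ, ℂ) ω Ucov) (p : Ucov → E),
      IsCoveringMap p ∧ Function.Surjective p ∧ MDifferentiable 𝓘(ℂ, ℂ) 𝓘(ℂ, ℂ) p ∧ IsAutHolDisc Ucov :=
  exists_universalCover_isAutHolDisc_of_isPuncturedEllipticCurve E Complex.planeDomainDiscCovering_holds hE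

/-- **[AbsTopIII] Cor. 2.4 (b) at the genuine once-punctured elliptic curve** — unconditional: a
holomorphic universal covering `p : 𝔻 → E` with `Aut(𝔻/E) ⊆ Aut⁰(𝔻)`.
[cite: MochizukiAbsTopIII2015, Corollary 2.4 (b) p.54] -/
theorem exists_deckGroup_subset_autIdComponent_of_isPuncturedEllipticCurve'
    (hE : TorsionPointsDenseUniqueGroupLaw.IsPuncturedEllipticCurve E) :
    ∃ p : unitDiscOpens → E, IsCoveringMap p ∧ Function.Surjective p ∧
      MDifferentiable 𝓘(ℂ, ℂ) 𝓘(ℂ, ℂ) p ∧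
      ((deckGroup p : Subgroup (unitDiscOpens ≃ₜ unitDiscOpens)) :
          Set (unitDiscOpens ≃ₜ unitDiscOpens)) ⊆
        autIdComponent (AutHolStructure.ofCharted unitDiscOpens) :=
  exists_deckGroup_subset_autIdComponent_of_isPuncturedEllipticCurve E
    Complex.planeDomainDiscCovering_holds hE

/-- **[AbsTopIII] Cor. 2.4 (c) at the genuine once-punctured elliptic curve** — unconditional except for
the printed non-arithmeticity hypothesis (`IsMargulisNonArithmetic`).
[cite: MochizukiAbsTopIII2015, Corollary 2.4 (c) p.55] -/
theorem exists_hyperbolicCore_data_of_isPuncturedEllipticCurve'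
    (hE : TorsionPointsDenseUniqueGroupLaw.IsPuncturedEllipticCurve E) :
    ∃ p : unitDiscOpens → E, IsCoveringMap p ∧ Function.Surjective p ∧
      MDifferentiable 𝓘(ℂ, ℂ) 𝓘(ℂ, ℂ) p ∧
      ∀ G : Subgroup (unitDiscOpens ≃ₜ unitDiscOpens),
        (G : Set (unitDiscOpens ≃ₜ unitDiscOpens)) =
            autIdComponent (AutHolStructure.ofCharted unitDiscOpens) →
        IsMargulisNonArithmetic G (deckGroup p) →
        let Pc : Subgroup (unitDiscOpens ≃ₜ unitDiscOpens) :=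
          (Subgroup.Commensurable.commensurator ((deckGroup p).subgroupOf G)).map G.subtype
        (∀ K L : Set unitDiscOpens, IsCompact K → IsCompact L →
            {γ : unitDiscOpens ≃ₜ unitDiscOpens | γ ∈ Pc ∧ (γ '' K ∩ L).Nonempty}.Finite) ∧
          (∀ x : unitDiscOpens, {γ : unitDiscOpens ≃ₜ unitDiscOpens | γ ∈ Pc ∧ γ x = x}.Finite) ∧
          ((Pc : Set (unitDiscOpens ≃ₜ unitDiscOpens)) ⊆
            autSet (AutHolStructure.ofCharted unitDiscOpens)) :=
  exists_hyperbolicCore_data_of_isPuncturedEllipticCurve E Complex.planeDomainDiscCovering_holds hE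

end HolomorphicEllipticCuspidalization

end Literature.AnabelianGeometry.AbsoluteAnabelian

end
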